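import Summits.Ventures.YMGap.Conjectures.TubeStringTensionReduced
import Summits.Ventures.YMGap.FlowData.TubeAxisSymmetry
import HarnessLib

/-!
# Venture YMGap — the tube string-tension law «L-Y3-σ», typed along axis `0`, is the law along EVERY axis
# (theorems only; the conjecture text is untouched)

HONEST FRAMING: venture file of the cell `pub-ymgap` (QuantumFields programme), track Y3.  Companion THEOREMS about
the typed conjectures `TubeStringTensionLawDim3` / `TubeStringTensionLawDim4` of `Conjectures/TubeStringTension.lean`
(item (12), commit 840feeed49aa; text NOT modified): they are stated for the flux sector along axis `0` of the cubic
cross-section; by the axis symmetry of the torelon energy (`FlowData.su2TorelonEnergy_axis`, coordinate permutations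
of the torus) and the reduction to the bare inequality (`tubeStringTensionLawDim3_iff_energy`), each is EQUIVALENT to
the same inequality for every axis `μ`.  Nothing here decides the conjectures; finite tori only; nothing about
`L → ∞`, the continuum, a string tension or a mass gap.

References: G. 't Hooft, Nucl. Phys. B 153 (1979) 141 [cite: tHooft1979Flux].
-/

noncomputable section

open Summit.Ventures.YMGap.FlowData

namespace Summit.Ventures.YMGap.Conjectures

/-- **«L-Y3-σ» (d = 3) holds along axis `0` iff it holds along every axis**:
`TubeStringTensionLawDim3 ↔ ∀ L β > 0 μ, E₁^{(μ)}((ℤ/L)²; β) < L · (−ln u(β))`. [cite: tHooft1979Flux] -/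
theorem tubeStringTensionLawDim3_iff_allAxes :
    TubeStringTensionLawDim3 ↔ ∀ (L : ℕ) [NeZero L] (β : ℝ), 0 < β → ∀ μ : Fin 2,
      su2TorelonEnergy β 2 L μ < (L : ℝ) * (-Real.log (su2CharacterRatio β)) := by
  rw [tubeStringTensionLawDim3_iff_energy]
  refine ⟨fun h L _ β hβ μ => ?_, fun h L _ β hβ => h L β hβ 0⟩
  rw [su2TorelonEnergy_axis β 2 L μ 0]
  exact h L β hβ

/-- **«L-Y3-σ» (d = 4 twin) holds along axis `0` iff it holds along every axis** of the cubic cross-section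
`(ℤ/L)³`. [cite: tHooft1979Flux] -/
theorem tubeStringTensionLawDim4_iff_allAxes :
    TubeStringTensionLawDim4 ↔ ∀ (L : ℕ) [NeZero L] (β : ℝ), 0 < β → ∀ μ : Fin 3,
      su2TorelonEnergy β 3 L μ < (L : ℝ) * (-Real.log (su2CharacterRatio β)) := by
  rw [tubeStringTensionLawDim4_iff_energy]
  refine ⟨fun h L _ β hβ μ => ?_, fun h L _ β hβ => h L β hβ 0⟩
  rw [su2TorelonEnergy_axis β 3 L μ 0]
  exact h L β hβ

/-- **The sector top along every axis is the same positive number**: `su2SectorTop β k L μ = su2SectorTop β k L ν`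
(coordinate permutation), and it is `> 0` for `β ≠ 0`. [cite: tHooft1979Flux] -/
theorem su2SectorTop_axis (β : ℝ) (k L : ℕ) [NeZero L] (μ ν : Fin k) : su2SectorTop β k L μ = su2SectorTop β k L ν := by
  haveI : SecondCountableTopology (Matrix.specialUnitaryGroup (Fin 2) ℂ) :=
    Literature.MathematicalPhysics.QuantumLattice.secondCountableTopology_su2
  unfold su2SectorTop
  have h := tubeSectorNorm_perm (Literature.MathematicalPhysics.QuantumLattice.fundamentalRep (Fin 2)) (β / 2)
    (L := L) (Equiv.swap μ ν) (Literature.MathematicalPhysics.QuantumLattice.continuous_fundamentalRep (Fin 2))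
    Literature.MathematicalPhysics.QuantumLattice.fundamentalRep_mem_unitaryGroup su2MinusOne (Pi.single μ 1)
  have he : ((Pi.single μ 1 : Fin k → ZMod 2) ∘ (Equiv.swap μ ν)) = Pi.single ν 1 := by
    funext i
    simp only [Function.comp_apply, Pi.single_apply, Equiv.swap_apply_eq_iff, Equiv.swap_apply_left]
  rw [he] at h
  exact h.symm

end Summit.Ventures.YMGap.Conjectures
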